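import Summits.AtomisticToContinuum.Crystallization.Theorems.FrustratedLawDichotomyTwoShellRigidityCells
import Summits.AtomisticToContinuum.Crystallization.Theorems.FrustratedLawDichotomyCappedRigidityCertPatterns
import Summits.AtomisticToContinuum.Crystallization.Theorems.FrustratedLawDichotomyLinkIsoToolkit
import Summits.AtomisticToContinuum.Crystallization.Theorems.FrustratedLawDichotomyBondGraphWindows
import Literature.Geometry.DiscreteGeometry.TwoShellPatterns
import Literature.Geometry.DiscreteGeometry.KissingRigidity

/-!
# OverbindingBudget — the TWO-SHELL SEAM: slot 3 `TwoShellShape` of the RDEF cone from FLD's `G ∧ P ∧ M⁺` plus a coverage lemma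

Helper file (`--supports stmt-AtomisticToContinuum-31280`, lens-3 g29).  Slot 3 of the cone of record
(`OverbindingBudgetShellHoleCone.rdef_of_ceg_shape_registered : ChargedEnergyGap → TwoShellShape (1/100) (3/50) (1/450) → …`)
is lens-4's `OverbindingBudgetTwoShellShape.TwoShellShape` — «BY NAME, lens-5 / census currency, NO PRODUCER IN TREE».  The FLD column
(`FrustratedLawDichotomyTwoShellRigidityCut/Cells`) types the finite two-shell pieces G = `LinkClassification`, P = `CapForcing`,
M⁺ = `CappedRigidityBoth θ η₁ η₂` and runs a certificate programme for them.  This file PROVES the seam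

  `G(1/100) → P(1/100) → M⁺(1/100, η₁, η₂) → η₁, η₂ ≤ ε ≤ 3/50 → TwoShellCover (1/100) ε g → TwoShellShapeV (1/100) ε g`,

where `TwoShellCover` (§1) is the one genuinely new piece — a statement of ELEMENTARY GEOMETRY about the two ideal patterns (every point at
distance `∈ [1, 3/2 + g]` from the centre lies in the exclusion ball of an ideal first-shell point or of an ideal cap) — proved at the literals
`(1/100, 3/50, 1/450)` in the companion files `OverbindingBudgetTwoShellCover*`.

CO-IMPORT NOTE.  `TwoShellShapeV` (§0) is the VERBATIM text of `OverbindingBudgetTwoShellShape.TwoShellShape`: that module (MuGSC family) and the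
FLD column (MuGroundStateConfiguration family) cannot be imported together (duplicate `Literature…UniformlyDiscrete`, TREE l.299 / INBOX l.167,
operator merge pending); the bridge `TwoShellShapeV θ ε g ↔ TwoShellShape θ ε g` is `Iff.rfl` the moment the two families co-import.

Contents: §0 the verbatim target; §1 the coverage piece; §2 the pattern dictionary (second shell = sums of square diagonals, by `decide` on the
integer models); §3 the seam at one pattern (`twoShellShapeV_core`) and at both (`twoShellShapeV_of_pieces`).
No `sorry`, no new axioms, no `instance` / `notation`.
-/

noncomputable section

namespace Summit.AtomisticToContinuum.Crystallization.Theorems.OverbindingBudgetTwoShellSeam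

open scoped Classical
open Literature.Geometry.DiscreteGeometry
open Summit.AtomisticToContinuum.Crystallization.Theorems.FrustratedLawDichotomyTwoShellRigidityCut
  (E3 LinkIso Capped CapForcingAt CapForcing LinkClassification)
open Summit.AtomisticToContinuum.Crystallization.Theorems.FrustratedLawDichotomyTwoShellRigidityCells
  (CappedRigidityBothAt CappedRigidityBoth)
open Summit.AtomisticToContinuum.Crystallization.Theorems.FrustratedLawDichotomyCappedRigidityCertPatterns
  (dist_eq_sqrt_two_iff_sqNormInt)
open Summit.AtomisticToContinuum.Crystallization.Theorems.FrustratedLawDichotomyBondGraphWindows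
  (nearestDist_pos_of_adj)

/-! ## §0 The target, verbatim -/

/-- **`TwoShellShapeV θ ε g`** — VERBATIM copy of `OverbindingBudgetTwoShellShape.TwoShellShape θ ε g` (lens-4, slot 3 of the RDEF cone):
at a site `i` of an injective `7/10`-separated configuration all of whose sites within `(5/2)·nearestDist y i` are charge-free(`θ`), a linear
isometric image of the fcc or the hcp TWO-SHELL pattern scaled by `nearestDist y i` and centred at `y i` is matched injectively by sites within
`ε·nearestDist y i`, and every site `≠ i` within `(3/2 + g)·nearestDist y i` is matched.  Copied, not imported, only because of the
MuGSC / MuGroundStateConfiguration co-import clash (module docstring); `Iff.rfl`-equal to the original. [UNDECIDED·TRUE-type; CERT] [piece] -/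
def TwoShellShapeV (θ ε g : ℝ) : Prop :=
  ∀ (N : ℕ) (y : Fin N → EuclideanSpace ℝ (Fin 3)) (i : Fin N), Function.Injective y →
    (∀ a b : Fin N, a ≠ b → (7 : ℝ) / 10 ≤ dist (y a) (y b)) →
    (∀ i' : Fin N, dist (y i') (y i) ≤ 5 / 2 * nearestDist y i → IsChargeFree θ y i') →
    ∃ (A : EuclideanSpace ℝ (Fin 3) →ₗᵢ[ℝ] EuclideanSpace ℝ (Fin 3)) (P : Finset (EuclideanSpace ℝ (Fin 3)))
      (f : EuclideanSpace ℝ (Fin 3) → EuclideanSpace ℝ (Fin 3)),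
      (P = fccTwoShellPattern ∨ P = hcpTwoShellPattern) ∧
      (∀ v ∈ P, f v ∈ Set.range y ∧ dist (f v) (y i + nearestDist y i • A v) ≤ ε * nearestDist y i) ∧ Set.InjOn f ↑P ∧
      ∀ k : Fin N, k ≠ i → dist (y k) (y i) ≤ (3 / 2 + g) * nearestDist y i → ∃ v ∈ P, f v = y k

/-! ## §1 The coverage piece (pure geometry of the ideal patterns) -/

/-- **`TwoShellCoverAt θ ε g Pat`** — COVERAGE GEOMETRY at one kissing pattern: for every linear isometry `A` and every point `p` with
`1 ≤ ‖p‖ ≤ 3/2 + g`, either `p` is within `1/(1+θ) − ε` of an ideal first-shell point `A u` (`u ∈ Pat`), or within `1/(1+θ)² − ε` of an ideal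
cap `A (u + v)` over a square diagonal (`u, v ∈ Pat`, `dist u v = √2`).  (These radii are the exclusion radii of the actual shell / cap sites,
measured at scale `nearestDist y i`, minus their fit.)  Why it might fail: only through the constants — at `(1/100, 3/50, 1/450)` the worst
direction is a triangle centre, angular margin `≈ 2°`. [WEAKER than slot 3 · elementary · proved in `OverbindingBudgetTwoShellCover`] [piece] -/
def TwoShellCoverAt (θ ε g : ℝ) (Pat : Finset E3) : Prop :=
  ∀ (A : E3 →ₗᵢ[ℝ] E3) (p : E3), 1 ≤ ‖p‖ → ‖p‖ ≤ 3 / 2 + g →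
    (∃ u ∈ Pat, ‖p - A u‖ < 1 / (1 + θ) - ε) ∨
      (∃ u ∈ Pat, ∃ v ∈ Pat, dist u v = Real.sqrt 2 ∧ ‖p - A (u + v)‖ < 1 / (1 + θ) ^ 2 - ε)

/-- **`TwoShellCover θ ε g`** — coverage geometry at both kissing patterns. [piece] -/
def TwoShellCover (θ ε g : ℝ) : Prop :=
  TwoShellCoverAt θ ε g fccKissingPattern ∧ TwoShellCoverAt θ ε g hcpKissingPattern

/-! ## §2 Pattern dictionary: the second shell is the set of sums of square diagonals -/

set_option maxRecDepth 8000 in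
/-- Integer cuboctahedron: the sum of a square diagonal (`|v − w|² = 4`) is a two-shell vector. [folklore] -/
theorem fccInt_add_mem_twoShell :
    ∀ v ∈ fccInt, ∀ w ∈ fccInt, sqNormInt (v - w) = 2 * ((2 : ℕ) : ℤ) → v + w ∈ fccInt ∪ fccSecondShellInt := by
  decide

set_option maxRecDepth 8000 in
/-- Integer anticuboctahedron: the sum of a square diagonal (`|v − w|² = 36`) is a two-shell vector. [folklore] -/
theorem hcpInt_add_mem_twoShell :
    ∀ v ∈ hcpInt, ∀ w ∈ hcpInt, sqNormInt (v - w) = 2 * ((18 : ℕ) : ℤ) → v + w ∈ hcpInt ∪ hcpSecondShellInt := by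
  decide

set_option maxRecDepth 8000 in
/-- Integer cuboctahedron: every two-shell vector is a first-shell vector or the sum of a square diagonal. [folklore] -/
theorem fccInt_twoShell_cases : ∀ x ∈ fccInt ∪ fccSecondShellInt,
    x ∈ fccInt ∨ ∃ v ∈ fccInt, ∃ w ∈ fccInt, sqNormInt (v - w) = 2 * ((2 : ℕ) : ℤ) ∧ x = v + w := by
  decide

set_option maxRecDepth 8000 in
/-- Integer anticuboctahedron: every two-shell vector is a first-shell vector or the sum of a square diagonal. [folklore] -/
theorem hcpInt_twoShell_cases : ∀ x ∈ hcpInt ∪ hcpSecondShellInt,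
    x ∈ hcpInt ∨ ∃ v ∈ hcpInt, ∃ w ∈ hcpInt, sqNormInt (v - w) = 2 * ((18 : ℕ) : ℤ) ∧ x = v + w := by
  decide

/-- Transport: sums of square diagonals of a scaled pattern lie in the scaled two-shell pattern. [folklore] -/
theorem add_mem_scaledPattern {S S₂ : Finset (Fin 3 → ℤ)} {N₀ : ℕ} (hN : N₀ ≠ 0)
    (h : ∀ v ∈ S, ∀ w ∈ S, sqNormInt (v - w) = 2 * (N₀ : ℤ) → v + w ∈ S₂) {u v : E3}
    (hu : u ∈ scaledPattern S N₀) (hv : v ∈ scaledPattern S N₀) (huv : dist u v = Real.sqrt 2) :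
    u + v ∈ scaledPattern S₂ N₀ := by
  simp only [scaledPattern, Finset.mem_image] at hu hv ⊢
  obtain ⟨a, ha, rfl⟩ := hu
  obtain ⟨b, hb, rfl⟩ := hv
  refine ⟨a + b, h a ha b hb ((dist_eq_sqrt_two_iff_sqNormInt hN a b).1 huv), ?_⟩
  rw [intVec_add, smul_add]

/-- Transport: a scaled two-shell vector is a first-shell vector or the sum of a square diagonal. [folklore] -/
theorem mem_scaledPattern_cases {S S₂ : Finset (Fin 3 → ℤ)} {N₀ : ℕ} (hN : N₀ ≠ 0)
    (h : ∀ x ∈ S₂, x ∈ S ∨ ∃ v ∈ S, ∃ w ∈ S, sqNormInt (v - w) = 2 * (N₀ : ℤ) ∧ x = v + w) {x : E3}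
    (hx : x ∈ scaledPattern S₂ N₀) :
    x ∈ scaledPattern S N₀ ∨
      ∃ u ∈ scaledPattern S N₀, ∃ v ∈ scaledPattern S N₀, dist u v = Real.sqrt 2 ∧ x = u + v := by
  simp only [scaledPattern, Finset.mem_image] at hx ⊢
  obtain ⟨c, hc, rfl⟩ := hx
  rcases h c hc with hc1 | ⟨a, ha, b, hb, hab, rfl⟩
  · exact Or.inl ⟨c, hc1, rfl⟩
  · refine Or.inr ⟨_, ⟨a, ha, rfl⟩, _, ⟨b, hb, rfl⟩, (dist_eq_sqrt_two_iff_sqNormInt hN a b).2 hab, ?_⟩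
    rw [intVec_add, smul_add]

/-- fcc: the sum of a link-square diagonal is a two-shell pattern point. [folklore] -/
theorem add_mem_fccTwoShellPattern {u v : E3} (hu : u ∈ fccKissingPattern) (hv : v ∈ fccKissingPattern)
    (huv : dist u v = Real.sqrt 2) : u + v ∈ fccTwoShellPattern :=
  add_mem_scaledPattern two_ne_zero fccInt_add_mem_twoShell hu hv huv

/-- hcp: the sum of a link-square diagonal is a two-shell pattern point. [folklore] -/
theorem add_mem_hcpTwoShellPattern {u v : E3} (hu : u ∈ hcpKissingPattern) (hv : v ∈ hcpKissingPattern)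
    (huv : dist u v = Real.sqrt 2) : u + v ∈ hcpTwoShellPattern :=
  add_mem_scaledPattern (by norm_num) hcpInt_add_mem_twoShell hu hv huv

/-- fcc: a two-shell pattern point is a kissing point or the sum of a link-square diagonal. [folklore] -/
theorem mem_fccTwoShellPattern_cases {x : E3} (hx : x ∈ fccTwoShellPattern) :
    x ∈ fccKissingPattern ∨
      ∃ u ∈ fccKissingPattern, ∃ v ∈ fccKissingPattern, dist u v = Real.sqrt 2 ∧ x = u + v :=
  mem_scaledPattern_cases two_ne_zero fccInt_twoShell_cases hx

/-- hcp: a two-shell pattern point is a kissing point or the sum of a link-square diagonal. [folklore] -/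
theorem mem_hcpTwoShellPattern_cases {x : E3} (hx : x ∈ hcpTwoShellPattern) :
    x ∈ hcpKissingPattern ∨
      ∃ u ∈ hcpKissingPattern, ∃ v ∈ hcpKissingPattern, dist u v = Real.sqrt 2 ∧ x = u + v :=
  mem_scaledPattern_cases (by norm_num) hcpInt_twoShell_cases hx

/-! ## §3 The seam -/

/-- In an injective configuration, a site within `nearestDist y m` of `y m` is `m`. [folklore] -/
theorem eq_of_dist_lt_nearestDist {N : ℕ} {y : Fin N → E3} {k m : Fin N} (h : dist (y m) (y k) < nearestDist y m) : k = m := by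
  by_contra hne
  exact (not_le.2 h) (nearestDist_le_dist y hne)

/-- **The seam at one pattern.**  At a site `i` with a charge-free `(5/2)·nn_i`-ball whose link is `Pat`-isomorphic via `τ`: P caps the
link, M⁺ fits shell and caps within `η₁, η₂ ≤ ε ≤ 3/50` of `nn_i·A(·)`; matching every two-shell pattern point with SOME site within `ε·nn_i`
of its ideal position gives the injective match (pattern points are `1`-separated, `2ε < 1`), and `TwoShellCoverAt` puts every site within
`(3/2 + g)·nn_i` inside the exclusion ball of a shell site (radius `≥ nn_i/(1+θ)`) or of a cap (radius `≥ nn_i/(1+θ)²`), hence equal to it.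
[this file] -/
theorem twoShellShapeV_core {Pat P₂ : Finset E3} {ε g η₁ η₂ : ℝ}
    (hP₂ : P₂ = fccTwoShellPattern ∨ P₂ = hcpTwoShellPattern) (hsub : Pat ⊆ P₂)
    (hadd : ∀ u ∈ Pat, ∀ v ∈ Pat, dist u v = Real.sqrt 2 → u + v ∈ P₂)
    (hcases : ∀ x ∈ P₂, x ∈ Pat ∨ ∃ u ∈ Pat, ∃ v ∈ Pat, dist u v = Real.sqrt 2 ∧ x = u + v)
    (hsep₂ : ∀ x ∈ P₂, ∀ x' ∈ P₂, x ≠ x' → 1 ≤ dist x x')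
    (hε : ε ≤ 3 / 50) (hη₁ : η₁ ≤ ε) (hη₂ : η₂ ≤ ε)
    (hPf : CapForcingAt (1 / 100) Pat) (hM : CappedRigidityBothAt (1 / 100) η₁ η₂ Pat)
    (hC : TwoShellCoverAt (1 / 100) ε g Pat) (hG : LinkClassification (1 / 100))
    {N : ℕ} {y : Fin N → E3} {i : Fin N} {τ : ↥Pat → Fin N} (hy : Function.Injective y)
    (hsep : ∀ a b : Fin N, a ≠ b → (7 : ℝ) / 10 ≤ dist (y a) (y b))
    (hball : ∀ i' : Fin N, dist (y i') (y i) ≤ 5 / 2 * nearestDist y i → IsChargeFree (1 / 100 : ℝ) y i')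
    (hL : LinkIso (1 / 100) Pat y i τ) :
    ∃ (A : E3 →ₗᵢ[ℝ] E3) (P : Finset E3) (f : E3 → E3),
      (P = fccTwoShellPattern ∨ P = hcpTwoShellPattern) ∧
      (∀ v ∈ P, f v ∈ Set.range y ∧ dist (f v) (y i + nearestDist y i • A v) ≤ ε * nearestDist y i) ∧
      Set.InjOn f ↑P ∧
      ∀ k : Fin N, k ≠ i → dist (y k) (y i) ≤ (3 / 2 + g) * nearestDist y i → ∃ v ∈ P, f v = y k := by
  have h101 : (0 : ℝ) ≤ 1 + 1 / 100 := by norm_num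
  have hnn0 : 0 ≤ nearestDist y i := nearestDist_nonneg y i
  -- the centre and its bonded neighbours are charge-free; the neighbours' links are classified
  have hcf : IsChargeFree (1 / 100 : ℝ) y i :=
    hball i (by rw [dist_self]; exact mul_nonneg (by norm_num) hnn0)
  have hnb : ∀ j : Fin N, (bondGraph (1 / 100 : ℝ) y).Adj i j → IsChargeFree (1 / 100 : ℝ) y j := by
    intro j hij
    apply hball
    rw [dist_comm]
    exact (dist_le_of_adj h101 hij).trans (mul_le_mul_of_nonneg_right (by norm_num) hnn0)
  have hGnb : ∀ j : Fin N, (bondGraph (1 / 100 : ℝ) y).Adj i j →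
      (∃ τ' : ↥fccKissingPattern → Fin N, LinkIso (1 / 100) fccKissingPattern y j τ') ∨
        (∃ τ' : ↥hcpKissingPattern → Fin N, LinkIso (1 / 100) hcpKissingPattern y j τ') :=
    fun j hij => hG N y hy hsep j (hnb j hij)
  have hCap : Capped (1 / 100) Pat y i τ := hPf N y i τ hy hsep hcf hnb hL hGnb
  obtain ⟨A, hfit1, hfit2⟩ := hM N y i τ hy hsep hL hCap
  -- the scale `nn = nearestDist y i` is positive
  have hP₂ne : P₂.Nonempty := by
    rw [← Finset.card_pos, card_eq_eighteen_of_twoShellPattern hP₂]; norm_num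
  obtain ⟨u₀, hu₀⟩ : Pat.Nonempty := by
    obtain ⟨x, hx⟩ := hP₂ne
    rcases hcases x hx with h | ⟨u, hu, _⟩
    exacts [⟨x, h⟩, ⟨u, hu⟩]
  set nn := nearestDist y i with hnn_def
  have hnn : 0 < nn := nearestDist_pos_of_adj hy (hL.1 ⟨u₀, hu₀⟩)
  -- own scales: shell sites `≥ nn/(1+θ)`, caps `≥ nn/(1+θ)²`
  have hshell_nn : ∀ u : ↥Pat, nn ≤ (1 + 1 / 100) * nearestDist y (τ u) := fun u =>
    nearestDist_le_mul_of_adj h101 (hL.1 u)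
  have hcap_nn : ∀ (m : Fin N) (w : ↥Pat), (bondGraph (1 / 100 : ℝ) y).Adj m (τ w) →
      nn ≤ (1 + 1 / 100) ^ 2 * nearestDist y m := by
    intro m w hmw
    have h1 := hshell_nn w
    have h2 : nearestDist y (τ w) ≤ (1 + 1 / 100) * nearestDist y m := nearestDist_le_mul_of_adj h101 hmw.symm
    nlinarith
  -- ideal positions and the existence of a fitting site at every two-shell pattern point
  let c : E3 → E3 := fun x => y i + nn • A x
  have hc_shell : ∀ u : ↥Pat, dist (y (τ u)) (c u) ≤ η₁ * nn := by
    intro u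
    rw [dist_eq_norm, show y (τ u) - c u = (y (τ u) - y i) - nn • A u by simp only [c]; abel]
    exact hfit1 u
  have hc_cap : ∀ (u v : ↥Pat) (m : Fin N), dist (u : E3) (v : E3) = Real.sqrt 2 → m ≠ i →
      (∀ w : ↥Pat, (w = u ∨ w = v ∨ (dist (w : E3) (u : E3) = 1 ∧ dist (w : E3) (v : E3) = 1)) →
        (bondGraph (1 / 100 : ℝ) y).Adj m (τ w)) → dist (y m) (c ((u : E3) + (v : E3))) ≤ η₂ * nn := by
    intro u v m huv hmi hm
    rw [dist_eq_norm, show y m - c ((u : E3) + (v : E3)) = (y m - y i) - nn • A ((u : E3) + (v : E3)) by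
      simp only [c]; abel]
    exact hfit2 u v m huv hmi hm
  have hex : ∀ x ∈ P₂, ∃ m : Fin N, dist (y m) (c x) ≤ ε * nn := by
    intro x hx
    rcases hcases x hx with hxP | ⟨u, hu, v, hv, huv, rfl⟩
    · exact ⟨τ ⟨x, hxP⟩, (hc_shell ⟨x, hxP⟩).trans (mul_le_mul_of_nonneg_right hη₁ hnn.le)⟩
    · obtain ⟨m, hmi, hm⟩ := hCap ⟨u, hu⟩ ⟨v, hv⟩ huv
      exact ⟨m, (hc_cap ⟨u, hu⟩ ⟨v, hv⟩ m huv hmi hm).trans (mul_le_mul_of_nonneg_right hη₂ hnn.le)⟩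
  -- the matching: SOME site within `ε·nn` of the ideal position
  let f : E3 → E3 := fun x => if h : ∃ m : Fin N, dist (y m) (c x) ≤ ε * nn then y (Classical.choose h) else y i
  have hf_range : ∀ x, f x ∈ Set.range y := by
    intro x
    by_cases h : ∃ m : Fin N, dist (y m) (c x) ≤ ε * nn
    · simp only [f, dif_pos h]; exact ⟨_, rfl⟩
    · simp only [f, dif_neg h]; exact ⟨_, rfl⟩
  have hf_fit : ∀ x ∈ P₂, dist (f x) (c x) ≤ ε * nn := by
    intro x hx
    have h := hex x hx
    simp only [f, dif_pos h]
    exact Classical.choose_spec h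
  have hf_eq : ∀ x ∈ P₂, ∀ m : Fin N, dist (y m) (c x) ≤ ε * nn → 2 * ε * nn < nearestDist y m → f x = y m := by
    intro x hx m hm hrad
    have h := hex x hx
    simp only [f, dif_pos h]
    have hm'c : dist (y (Classical.choose h)) (c x) ≤ ε * nn := Classical.choose_spec h
    by_contra hne
    have hne' : Classical.choose h ≠ m := fun e => hne (by rw [e])
    have h1 : nearestDist y m ≤ dist (y m) (y (Classical.choose h)) := nearestDist_le_dist y hne'
    have h2 : dist (y m) (y (Classical.choose h)) ≤ ε * nn + ε * nn :=
      (dist_triangle _ (c x) _).trans (add_le_add hm (by rw [dist_comm]; exact hm'c))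
    linarith
  -- injectivity on the pattern: ideal positions are `nn`-separated, fits are `ε·nn`, `2ε < 1`
  have hcc : ∀ x x' : E3, dist (c x) (c x') = nn * dist x x' := by
    intro x x'
    simp only [c, dist_eq_norm]
    rw [add_sub_add_left_eq_sub, ← smul_sub, norm_smul, Real.norm_of_nonneg hnn.le, ← map_sub, A.norm_map]
  have hinj : Set.InjOn f ↑P₂ := by
    intro x hx x' hx' hfx
    by_contra hne
    have hd : 1 ≤ dist x x' := hsep₂ x hx x' hx' hne
    have h1 := hf_fit x hx
    have h2 := hf_fit x' hx'
    rw [hfx] at h1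
    have h3 : dist (c x) (c x') ≤ ε * nn + ε * nn :=
      (dist_triangle _ (f x') _).trans (add_le_add (by rw [dist_comm]; exact h1) h2)
    rw [hcc] at h3
    nlinarith
  -- coverage
  have hcov : ∀ k : Fin N, k ≠ i → dist (y k) (y i) ≤ (3 / 2 + g) * nn → ∃ v ∈ P₂, f v = y k := by
    intro k hki hk
    set p : E3 := nn⁻¹ • (y k - y i) with hp
    have hpk : ∀ z : E3, dist (y k) (c z) = nn * ‖p - A z‖ := by
      intro z
      simp only [c, dist_eq_norm]
      rw [show y k - (y i + nn • A z) = nn • (p - A z) by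
        rw [hp, smul_sub, smul_smul, mul_inv_cancel₀ hnn.ne', one_smul]; abel]
      rw [norm_smul, Real.norm_of_nonneg hnn.le]
    have hnorm : ‖p‖ = nn⁻¹ * dist (y k) (y i) := by
      rw [hp, norm_smul, norm_inv, Real.norm_of_nonneg hnn.le, dist_eq_norm]
    have hp1 : 1 ≤ ‖p‖ := by
      rw [hnorm, le_inv_mul_iff₀ hnn, mul_one, dist_comm]
      exact nearestDist_le_dist y hki
    have hp2 : ‖p‖ ≤ 3 / 2 + g := by
      rw [hnorm, inv_mul_le_iff₀ hnn, mul_comm]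
      exact hk
    rcases hC A p hp1 hp2 with ⟨u, hu, hclose⟩ | ⟨u, hu, v, hv, huv, hclose⟩
    · -- `y k` lies in the exclusion ball of the shell site `τ u`
      have hfit : dist (y (τ ⟨u, hu⟩)) (c u) ≤ η₁ * nn := hc_shell ⟨u, hu⟩
      have hrad : nn ≤ (1 + 1 / 100) * nearestDist y (τ ⟨u, hu⟩) := hshell_nn ⟨u, hu⟩
      have hlt : nn * ‖p - A u‖ < nn * (1 / (1 + 1 / 100) - ε) := mul_lt_mul_of_pos_left hclose hnn
      have hkeq : k = τ ⟨u, hu⟩ := by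
        apply eq_of_dist_lt_nearestDist
        have h2 : dist (y (τ ⟨u, hu⟩)) (y k) ≤ η₁ * nn + nn * ‖p - A u‖ := by
          calc dist (y (τ ⟨u, hu⟩)) (y k) ≤ dist (y (τ ⟨u, hu⟩)) (c u) + dist (c u) (y k) := dist_triangle _ _ _
            _ ≤ η₁ * nn + nn * ‖p - A u‖ := add_le_add hfit (by rw [dist_comm, hpk])
        have h4 : η₁ * nn ≤ ε * nn := mul_le_mul_of_nonneg_right hη₁ hnn.le
        nlinarith
      refine ⟨u, hsub hu, ?_⟩
      rw [hkeq]
      refine hf_eq u (hsub hu) (τ ⟨u, hu⟩) (hfit.trans (mul_le_mul_of_nonneg_right hη₁ hnn.le)) ?_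
      nlinarith
    · -- `y k` lies in the exclusion ball of a cap over the diagonal `u, v`
      obtain ⟨m, hmi, hm⟩ := hCap ⟨u, hu⟩ ⟨v, hv⟩ huv
      have hfit : dist (y m) (c (u + v)) ≤ η₂ * nn := hc_cap ⟨u, hu⟩ ⟨v, hv⟩ m huv hmi hm
      have hrad : nn ≤ (1 + 1 / 100) ^ 2 * nearestDist y m := hcap_nn m ⟨u, hu⟩ (hm ⟨u, hu⟩ (Or.inl rfl))
      have hlt : nn * ‖p - A (u + v)‖ < nn * (1 / (1 + 1 / 100) ^ 2 - ε) := mul_lt_mul_of_pos_left hclose hnn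
      have hkeq : k = m := by
        apply eq_of_dist_lt_nearestDist
        have h2 : dist (y m) (y k) ≤ η₂ * nn + nn * ‖p - A (u + v)‖ := by
          calc dist (y m) (y k) ≤ dist (y m) (c (u + v)) + dist (c (u + v)) (y k) := dist_triangle _ _ _
            _ ≤ η₂ * nn + nn * ‖p - A (u + v)‖ := add_le_add hfit (by rw [dist_comm, hpk])
        have h4 : η₂ * nn ≤ ε * nn := mul_le_mul_of_nonneg_right hη₂ hnn.le
        nlinarith
      refine ⟨u + v, hadd u hu v hv huv, ?_⟩
      rw [hkeq]
      refine hf_eq (u + v) (hadd u hu v hv huv) m (hfit.trans (mul_le_mul_of_nonneg_right hη₂ hnn.le)) ?_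
      nlinarith
  exact ⟨A, P₂, f, hP₂, fun v hv => ⟨hf_range v, hf_fit v hv⟩, hinj, hcov⟩

/-- **THE SEAM.**  `G(1/100) → P(1/100) → M⁺(1/100, η₁, η₂) → (η₁, η₂ ≤ ε ≤ 3/50) → TwoShellCover (1/100) ε g → TwoShellShapeV (1/100) ε g`.
[this file] -/
theorem twoShellShapeV_of_pieces {ε g η₁ η₂ : ℝ} (hε : ε ≤ 3 / 50) (hη₁ : η₁ ≤ ε) (hη₂ : η₂ ≤ ε)
    (hG : LinkClassification (1 / 100)) (hP : CapForcing (1 / 100)) (hM : CappedRigidityBoth (1 / 100) η₁ η₂)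
    (hC : TwoShellCover (1 / 100) ε g) : TwoShellShapeV (1 / 100) ε g := by
  intro N y i hy hsep hball
  have hcf : IsChargeFree (1 / 100 : ℝ) y i :=
    hball i (by rw [dist_self]; exact mul_nonneg (by norm_num) (nearestDist_nonneg y i))
  rcases hG N y hy hsep i hcf with ⟨τ, hL⟩ | ⟨τ, hL⟩
  · exact twoShellShapeV_core (Or.inl rfl) fccKissingPattern_subset
      (fun u hu v hv huv => add_mem_fccTwoShellPattern hu hv huv) (fun x hx => mem_fccTwoShellPattern_cases hx)
      (fun x hx x' hx' hne => one_le_dist_of_mem_fccTwoShellPattern hx hx' hne) hε hη₁ hη₂ hP.1 hM.1 hC.1 hG hy hsep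
      hball hL
  · exact twoShellShapeV_core (Or.inr rfl) hcpKissingPattern_subset
      (fun u hu v hv huv => add_mem_hcpTwoShellPattern hu hv huv) (fun x hx => mem_hcpTwoShellPattern_cases hx)
      (fun x hx x' hx' hne => one_le_dist_of_mem_hcpTwoShellPattern hx hx' hne) hε hη₁ hη₂ hP.2 hM.2 hC.2 hG hy hsep
      hball hL

end Summit.AtomisticToContinuum.Crystallization.Theorems.OverbindingBudgetTwoShellSeam

end
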